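import Summits.Ventures.PercRepro.S2SpanningCount
import Summits.Ventures.PercRepro.S2RankThreeCount
import Summits.Ventures.PercRepro.S2IndepFiveCount

/-!
# PercRepro — S2: THE SPANNING SETS OF A CORE WITH THREE TRIANGLES (p7, gen 12; sub-claim S2; the `p = 15` row)

THE TRIANGLE TRADE-OFF of the spread case: a spanning set of `p + 1` or more points is the complement of a set of `< d` points
(`Σ_{j < d} C(n, j)` of those), and a spanning set of exactly `p` points is a BASIS — a `p`-subset containing no circuit. Every
`p`-subset through a triangle `T` is dependent; through each of three distinct triangles there are `C(n − 3, p − 3) = C(n − 3, d)`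
`p`-subsets, and two distinct triangles of a core share `≤ 1` point (`S2.card_inter_le_one_of_triangles`), so their `p`-subsets
overlap in `≤ C(n − 5, d)` (Bonferroni):
  `#{X ⊆ E : ρ(X) = ρ(E)} + 3·C(n − 3, d) ≤ Σ_{j < d} C(n, j) + C(n, p) + 3·C(n − 5, d)`
(**`ncard_spanning_add_le_of_three_triangles`**). At `(15, 7)` with `s₃ ≥ 3`: `#spanning ≤ 110,056 + 170,544 + 58,344 − 151,164 = 187,780`
against the kit's `280,600` — the tail's slack drops from `101/1024` to `78/1024` (S2 v35 §R3⁗(t)(5)). Axioms: standard.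
-/

open scoped Matroid

namespace PercRepro

namespace S2

open Set

variable {α : Type}

/-- **Two distinct triangles of a core span `≥ 5` points** (they share `≤ 1` point). -/
theorem five_le_ncard_union_of_triangles (M : Matroid α) [M.Finite]
    (hC1 : ∀ L ⊆ M.E, M.eRk L = 2 → L.ncard ≤ 3)
    {T T' : Set α} (hT : M.IsCircuit T) (hT3 : T.ncard = 3) (hT' : M.IsCircuit T') (hT'3 : T'.ncard = 3)
    (hne : T ≠ T') : 5 ≤ (T ∪ T').ncard := by
  classical
  have hTfin : T.Finite := M.ground_finite.subset hT.subset_ground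
  have hT'fin : T'.Finite := M.ground_finite.subset hT'.subset_ground
  have hcT : ((hTfin.toFinset : Finset α) : Set α) = T := Set.Finite.coe_toFinset _
  have hcT' : ((hT'fin.toFinset : Finset α) : Set α) = T' := Set.Finite.coe_toFinset _
  have h := card_inter_le_one_of_triangles (M := M) hC1 (T := hTfin.toFinset) (T' := hT'fin.toFinset)
    (by rw [hcT]; exact hT) (by rw [← Set.ncard_eq_toFinset_card T hTfin]; exact hT3)
    (by rw [hcT']; exact hT') (by rw [← Set.ncard_eq_toFinset_card T' hT'fin]; exact hT'3)
    (by
      intro heq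
      apply hne
      rw [← hcT, ← hcT', heq])
  have hi : (T ∩ T').ncard ≤ 1 := by
    rw [← hcT, ← hcT', ← Finset.coe_inter, Set.ncard_coe_finset]
    exact h
  have hu := Set.ncard_union_add_ncard_inter T T' hTfin hT'fin
  omega

/-- **The `p`-subsets through a `u`-set**: at most `C(n − u, p − u)` subsets of `E` of size `p` contain a given `U ⊆ E` of size `u`
(`X ↦ X ∖ U` is injective into the `(p − u)`-subsets of `E ∖ U`). -/
theorem ncard_subsets_superset_le (M : Matroid α) [M.Finite] {U : Set α} (hU : U ⊆ M.E) (p : ℕ) :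
    {X : Set α | X ⊆ M.E ∧ X.ncard = p ∧ U ⊆ X}.ncard ≤ (M.E.ncard - U.ncard).choose (p - U.ncard) := by
  classical
  have hUfin : U.Finite := M.ground_finite.subset hU
  have hmaps : ∀ X ∈ {X : Set α | X ⊆ M.E ∧ X.ncard = p ∧ U ⊆ X},
      (fun X : Set α => X \ U) X ∈ {Y : Set α | Y ⊆ M.E \ U ∧ Y.ncard = p - U.ncard} := by
    rintro X ⟨hXE, hXp, hUX⟩
    refine ⟨Set.sdiff_subset_sdiff_left hXE, ?_⟩
    rw [Set.ncard_sdiff hUX hUfin, hXp]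
  have hinj : Set.InjOn (fun X : Set α => X \ U) {X : Set α | X ⊆ M.E ∧ X.ncard = p ∧ U ⊆ X} := by
    intro X hX Y hY hXY
    simp only at hXY
    rw [← Set.sdiff_union_of_subset hX.2.2, hXY, Set.sdiff_union_of_subset hY.2.2]
  calc {X : Set α | X ⊆ M.E ∧ X.ncard = p ∧ U ⊆ X}.ncard
      ≤ {Y : Set α | Y ⊆ M.E \ U ∧ Y.ncard = p - U.ncard}.ncard :=
        Set.ncard_le_ncard_of_injOn _ hmaps hinj
          ((M.ground_finite.sdiff).finite_subsets.subset (fun Y hY => hY.1))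
    _ = (M.E \ U).ncard.choose (p - U.ncard) := ncard_subsets_ncard_eq (M.E \ U) (M.ground_finite.sdiff) _
    _ = (M.E.ncard - U.ncard).choose (p - U.ncard) := by rw [Set.ncard_sdiff hU hUfin]

/-- **The `p`-subsets through a `u`-set, from below**: at least `C(n − u, p − u)` of them (`Y ↦ Y ∪ U` from the `(p − u)`-subsets
of `E ∖ U`). -/
theorem choose_le_ncard_subsets_superset (M : Matroid α) [M.Finite] {U : Set α} (hU : U ⊆ M.E) (p : ℕ)
    (hup : U.ncard ≤ p) :
    (M.E.ncard - U.ncard).choose (p - U.ncard) ≤ {X : Set α | X ⊆ M.E ∧ X.ncard = p ∧ U ⊆ X}.ncard := by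
  classical
  have hUfin : U.Finite := M.ground_finite.subset hU
  have hmaps : ∀ Y ∈ {Y : Set α | Y ⊆ M.E \ U ∧ Y.ncard = p - U.ncard},
      (fun Y : Set α => Y ∪ U) Y ∈ {X : Set α | X ⊆ M.E ∧ X.ncard = p ∧ U ⊆ X} := by
    rintro Y ⟨hYE, hYp⟩
    have hYfin : Y.Finite := (M.ground_finite.sdiff).subset hYE
    have hdis : Disjoint Y U := Set.disjoint_of_subset_left hYE Set.disjoint_sdiff_left
    refine ⟨Set.union_subset (hYE.trans Set.sdiff_subset) hU, ?_, Set.subset_union_right⟩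
    rw [Set.ncard_union_eq hdis hYfin hUfin, hYp]
    omega
  have hinj : Set.InjOn (fun Y : Set α => Y ∪ U) {Y : Set α | Y ⊆ M.E \ U ∧ Y.ncard = p - U.ncard} := by
    intro Y hY Z hZ hYZ
    simp only at hYZ
    have hY' : (Y ∪ U) \ U = Y := by
      rw [Set.union_sdiff_right]
      exact sdiff_eq_self_iff_disjoint.2 (Set.disjoint_of_subset_left hY.1 Set.disjoint_sdiff_left).symm
    have hZ' : (Z ∪ U) \ U = Z := by
      rw [Set.union_sdiff_right]
      exact sdiff_eq_self_iff_disjoint.2 (Set.disjoint_of_subset_left hZ.1 Set.disjoint_sdiff_left).symm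
    calc Y = (Y ∪ U) \ U := hY'.symm
      _ = (Z ∪ U) \ U := by rw [hYZ]
      _ = Z := hZ'
  calc (M.E.ncard - U.ncard).choose (p - U.ncard)
      = (M.E \ U).ncard.choose (p - U.ncard) := by rw [Set.ncard_sdiff hU hUfin]
    _ = {Y : Set α | Y ⊆ M.E \ U ∧ Y.ncard = p - U.ncard}.ncard :=
        (ncard_subsets_ncard_eq (M.E \ U) (M.ground_finite.sdiff) _).symm
    _ ≤ {X : Set α | X ⊆ M.E ∧ X.ncard = p ∧ U ⊆ X}.ncard :=
        Set.ncard_le_ncard_of_injOn _ hmaps hinj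
          (M.ground_finite.finite_subsets.subset (fun X hX => hX.1))

/-- **The spanning sets of a core with three distinct triangles**:
`#{X ⊆ E : ρ(X) = ρ(E)} + 3·C(n − 3, d) ≤ Σ_{j < d} C(n, j) + C(n, p) + 3·C(n − 5, d)` (`n = |E| = p + d`). -/
theorem ncard_spanning_add_le_of_three_triangles (M : Matroid α) [M.Finite] {p d : ℕ}
    (hR : M.eRank = (p : ℕ∞)) (hn : M.E.ncard = p + d) (hp6 : 6 ≤ p)
    (hC1 : ∀ L ⊆ M.E, M.eRk L = 2 → L.ncard ≤ 3)
    {T₁ T₂ T₃ : Set α} (h₁ : M.IsCircuit T₁) (h₁c : T₁.ncard = 3) (h₂ : M.IsCircuit T₂) (h₂c : T₂.ncard = 3)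
    (h₃ : M.IsCircuit T₃) (h₃c : T₃.ncard = 3) (h12 : T₁ ≠ T₂) (h13 : T₁ ≠ T₃) (h23 : T₂ ≠ T₃) :
    {X : Set α | X ⊆ M.E ∧ M.eRk X = M.eRank}.ncard + 3 * (p + d - 3).choose d ≤
      ∑ m ∈ Finset.range d, (p + d).choose m + (p + d).choose p + 3 * (p + d - 5).choose d := by
  classical
  have hd : M.E.encard = M.eRank + d := by
    rw [hR, ← M.ground_finite.cast_ncard_eq, hn]
    push_cast
    ring
  -- (b) the spanning sets size by size through their complements
  have h1 := ncard_spanning_le_sum_compl M hd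
  rw [Finset.sum_range_succ] at h1
  -- (c) the complements of `< d` points
  have hsmall : ∑ m ∈ Finset.range d, {B : Set α | B ⊆ M.E ∧ B.ncard = m ∧ M.eRk (M.E \ B) = M.eRank}.ncard ≤
      ∑ m ∈ Finset.range d, (p + d).choose m := by
    refine Finset.sum_le_sum (fun m _ => ?_)
    calc {B : Set α | B ⊆ M.E ∧ B.ncard = m ∧ M.eRk (M.E \ B) = M.eRank}.ncard
        ≤ {B : Set α | B ⊆ M.E ∧ B.ncard = m}.ncard :=
          Set.ncard_le_ncard (fun B hB => ⟨hB.1, hB.2.1⟩)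
            (M.ground_finite.finite_subsets.subset (fun B hB => hB.1))
      _ = (p + d).choose m := by rw [ncard_subsets_ncard_eq M.E M.ground_finite m, hn]
  -- (d) the complements of exactly `d` points are the spanning `p`-sets
  set Sp := {X : Set α | X ⊆ M.E ∧ X.ncard = p ∧ M.eRk X = M.eRank} with hSp
  have hSpfin : Sp.Finite := M.ground_finite.finite_subsets.subset (fun X hX => hX.1)
  have hlast : {B : Set α | B ⊆ M.E ∧ B.ncard = d ∧ M.eRk (M.E \ B) = M.eRank}.ncard ≤ Sp.ncard := by
    have hmaps : ∀ B ∈ {B : Set α | B ⊆ M.E ∧ B.ncard = d ∧ M.eRk (M.E \ B) = M.eRank},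
        (fun B : Set α => M.E \ B) B ∈ Sp := by
      rintro B ⟨hBE, hBd, hBs⟩
      refine ⟨Set.sdiff_subset, ?_, hBs⟩
      rw [Set.ncard_sdiff hBE (M.ground_finite.subset hBE), hn, hBd]
      omega
    have hinj : Set.InjOn (fun B : Set α => M.E \ B)
        {B : Set α | B ⊆ M.E ∧ B.ncard = d ∧ M.eRk (M.E \ B) = M.eRank} := by
      intro X hX Y hY hXY
      simp only at hXY
      rw [← Set.sdiff_sdiff_cancel_left hX.1, hXY, Set.sdiff_sdiff_cancel_left hY.1]
    exact Set.ncard_le_ncard_of_injOn _ hmaps hinj hSpfin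
  -- (e) the spanning `p`-sets avoid the three triangles
  set P := {X : Set α | X ⊆ M.E ∧ X.ncard = p} with hP
  have hPfin : P.Finite := M.ground_finite.finite_subsets.subset (fun X hX => hX.1)
  have hPcard : P.ncard = (p + d).choose p := by rw [hP, ncard_subsets_ncard_eq M.E M.ground_finite p, hn]
  let S : Set α → Set (Set α) := fun T => {X : Set α | X ⊆ M.E ∧ X.ncard = p ∧ T ⊆ X}
  have hSsub : ∀ T, S T ⊆ P := fun T X hX => ⟨hX.1, hX.2.1⟩
  have hSfin : ∀ T, (S T).Finite := fun T => hPfin.subset (hSsub T)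
  have hdep : ∀ {T : Set α}, M.IsCircuit T → ∀ X ∈ Sp, ¬ T ⊆ X := by
    intro T hT X hX hTX
    have hXfin : X.Finite := M.ground_finite.subset hX.1
    have hD : M.Dep X := hT.dep.superset hTX hX.1
    have hlt := Matroid.eRk_lt_encard_of_dep_of_finite hXfin hD
    rw [hX.2.2, hR, ← hXfin.cast_ncard_eq, hX.2.1] at hlt
    exact lt_irrefl _ hlt
  have hUfin : (S T₁ ∪ S T₂ ∪ S T₃).Finite := ((hSfin T₁).union (hSfin T₂)).union (hSfin T₃)
  have hdisj : Disjoint Sp (S T₁ ∪ S T₂ ∪ S T₃) := by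
    rw [Set.disjoint_left]
    intro X hX hXU
    rcases hXU with (hX1 | hX2) | hX3
    · exact hdep h₁ X hX hX1.2.2
    · exact hdep h₂ X hX hX2.2.2
    · exact hdep h₃ X hX hX3.2.2
  -- (f) `#Sp + #U ≤ #P`
  have hSpU : Sp.ncard + (S T₁ ∪ S T₂ ∪ S T₃).ncard ≤ P.ncard := by
    rw [← Set.ncard_union_eq hdisj hSpfin hUfin]
    refine Set.ncard_le_ncard ?_ hPfin
    rintro X (hX | hX)
    · exact ⟨hX.1, hX.2.1⟩
    · rcases hX with (h | h) | h
      · exact hSsub _ h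
      · exact hSsub _ h
      · exact hSsub _ h
  -- (g) Bonferroni
  have hB1 := Set.ncard_union_add_ncard_inter (S T₁) (S T₂) (hSfin T₁) (hSfin T₂)
  have hB2 := Set.ncard_union_add_ncard_inter (S T₁ ∪ S T₂) (S T₃) ((hSfin T₁).union (hSfin T₂)) (hSfin T₃)
  have hB3 : ((S T₁ ∪ S T₂) ∩ S T₃).ncard ≤ (S T₁ ∩ S T₃).ncard + (S T₂ ∩ S T₃).ncard := by
    rw [Set.union_inter_distrib_right]
    exact Set.ncard_union_le _ _
  -- (h) each `S Tᵢ` has `≥ C(n − 3, d)` members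
  have hlow : ∀ {T : Set α}, M.IsCircuit T → T.ncard = 3 → (p + d - 3).choose d ≤ (S T).ncard := by
    intro T hT hTc
    have h := choose_le_ncard_subsets_superset M hT.subset_ground p (by omega)
    rw [hn, hTc] at h
    rwa [Nat.choose_symm_of_eq_add (show p + d - 3 = (p - 3) + d by omega)] at h
  -- (i) each pair has `≤ C(n − 5, d)` common members
  have hpair : ∀ {T T' : Set α}, M.IsCircuit T → T.ncard = 3 → M.IsCircuit T' → T'.ncard = 3 → T ≠ T' →
      (S T ∩ S T').ncard ≤ (p + d - 5).choose d := by
    intro T T' hT hTc hT' hT'c hne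
    have hu5 := five_le_ncard_union_of_triangles M hC1 hT hTc hT' hT'c hne
    have hu6 : (T ∪ T').ncard ≤ 6 := by
      have := Set.ncard_union_le T T'
      omega
    have hsub : S T ∩ S T' ⊆ {X : Set α | X ⊆ M.E ∧ X.ncard = p ∧ T ∪ T' ⊆ X} := by
      rintro X ⟨hX1, hX2⟩
      exact ⟨hX1.1, hX1.2.1, Set.union_subset hX1.2.2 hX2.2.2⟩
    have h := ncard_subsets_superset_le M (Set.union_subset hT.subset_ground hT'.subset_ground) p
    rw [hn] at h
    have hsym : (p + d - (T ∪ T').ncard).choose (p - (T ∪ T').ncard) = (p + d - (T ∪ T').ncard).choose d :=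
      Nat.choose_symm_of_eq_add (by omega)
    rw [hsym] at h
    calc (S T ∩ S T').ncard ≤ {X : Set α | X ⊆ M.E ∧ X.ncard = p ∧ T ∪ T' ⊆ X}.ncard :=
          Set.ncard_le_ncard hsub (hPfin.subset (fun X hX => ⟨hX.1, hX.2.1⟩))
      _ ≤ (p + d - (T ∪ T').ncard).choose d := h
      _ ≤ (p + d - 5).choose d := Nat.choose_le_choose d (by omega)
  have hl1 := hlow h₁ h₁c
  have hl2 := hlow h₂ h₂c
  have hl3 := hlow h₃ h₃c
  have hp12 := hpair h₁ h₁c h₂ h₂c h12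
  have hp13 := hpair h₁ h₁c h₃ h₃c h13
  have hp23 := hpair h₂ h₂c h₃ h₃c h23
  -- (j) assemble
  rw [hPcard] at hSpU
  omega

end S2

end PercRepro
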